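import Summits.KontsevichZagierPeriods.Zeta5Search.Barrier.ConeGammaCritBoxPoly
import Summits.KontsevichZagierPeriods.Zeta5Search.Barrier.ConeGammaCritBoxLog
import Summits.KontsevichZagierPeriods.Zeta5Search.Barrier.ConeGammaLemmaFBox

/-!
# ζ(5) search — BARRIER: CRITICAL VALUES ON BOXES — the computable checker (Poincaré–Miranda faces in exact
# integer polynomial arithmetic; critical values in affine arithmetic)

HONEST FRAMING (cell `pub-zeta5`): systematic search; no irrationality claim unless kernel-certified. Computable
integer / `EPoly` / `AForm` DATA and FUNCTIONS only (none Prop-valued, no named fact); the soundness theorems are in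
`ConeGammaCritBoxSound` / `ConeGammaCritBoxCert`. Objects: BZ's §5 critical system `F1R = F2R = 0` of
`ConeGammaRates` in the shifted symmetric coordinates `X = x − s₆`, `Y = y − s₆` (`F1R_aOfS`, `F2R_aOfS`; bidegrees
(2,1)/(1,2)), the FAR chart `Z = 1/Y` (`G₁ = Z·F₁(X,1/Z)`, `G₂ = Z²·F₂(X,1/Z)`), the growth functional
`growthLogR_aOfS`; MODEL objects under BZ (28)+(30). Nothing about any γ of record, C2 (OPEN), S-E or `ζ(5)`.
Theory seat cert-2 g37 (item «CRITICAL VALUES ON BOXES — KERNEL», INBOX plan 2026-08-27).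

DATA CONVENTIONS. A direction box is cert-2 g34/g36's `(D, lo, hi)`: `lo_i ≤ D·t_i ≤ hi_i` (`i = 1..7`), `t₀ = 1`,
`t = s/s₀`; noise variables `ε_i := (2D t_i − lo_i − hi_i)/(hi_i − lo_i) ∈ [−1,1]` (`i = 1..7`), `ε₈`, `ε₉` = the two
coordinates of a critical-point box. Polynomial atoms are INTEGER `EPoly`s standing for `Q·(real atom)` with
`Q = 2·D·T` (`T` an extra scale for the critical-point models): `Q t_i = T(lo_i+hi_i) + T(hi_i−lo_i) ε_i`,
`Q·X = cx + Σ_j ax_j ε_j + wx·(face or ε₈)`, … (`RootData`). A product of `k` atoms stands for `Q^k·(value)`;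
`F₁`, `F₂` are differences of products of four atom-sums (`Q⁴`), `G₁` of five (`Q⁵`), `G₂` of eight (`Q⁸`) — only
their SIGNS are used. Values: affine forms at scale `SC = 2⁶⁰` (`ConeGammaLemmaFBox.SC`).
-/

namespace Summit.KontsevichZagierPeriods.Zeta5Search.Barrier.ConeGamma

namespace CritBox

open Literature.Analysis.ValidatedNumerics (AForm)
open Literature.Analysis.ValidatedNumerics.AForm
open LemmaFBox (SC)

/-! ### Data -/

/-- Certificate data of ONE critical point: chart (`far = false`: coordinates `(X, Y)`; `far = true`: `(X, Z)`,
`Y = 1/Z`), the affinely moving box `Q·X = cx + Σ_{j=1..7} ax_j ε_j ± wx`, `Q·V = cv + Σ av_j ε_j ± wv`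
(`ax`, `av` listed for `j = 1..7`), and an integer preconditioner `M = (m₁₁, m₁₂; m₂₁, m₂₂)`. -/
structure RootData where
  /-- far chart? -/
  far : Bool
  /-- scaled centre of the first coordinate -/
  cx : ℤ
  /-- scaled sensitivities of the first coordinate to `ε₁..ε₇` -/
  ax : List ℤ
  /-- scaled half-width of the first coordinate -/
  wx : ℕ
  /-- scaled centre of the second coordinate (`Y` or `Z`) -/
  cv : ℤ
  /-- scaled sensitivities of the second coordinate -/
  av : List ℤ
  /-- scaled half-width of the second coordinate -/
  wv : ℕ
  /-- preconditioner entries -/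
  m11 : ℤ
  /-- preconditioner entries -/
  m12 : ℤ
  /-- preconditioner entries -/
  m21 : ℤ
  /-- preconditioner entries -/
  m22 : ℤ
  deriving DecidableEq, Repr

/-! ### Exact polynomial atoms (`EPoly`, value = `Q·atom`) -/

/-- `Q·t_i` for `i = 1..7` (`Q = 2DT`): `T(lo_i + hi_i) + T(hi_i − lo_i)·ε_i`; `Q·t₀ = Q`. -/
def tPoly (D T : ℕ) (lo hi : List ℕ) (i : Fin 8) : EPoly :=
  if i = 0 then EPoly.const (2 * D * T : ℕ)
  else EPoly.merge (EPoly.const ((T : ℤ) * ((lo.getD i 0 : ℤ) + (hi.getD i 0 : ℤ))))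
        (EPoly.var ((T : ℤ) * ((hi.getD i 0 : ℤ) - (lo.getD i 0 : ℤ))) i)

/-- The linear part `c + Σ_{j=1..7} a_j ε_j` as an `EPoly` (coefficients listed for `j = 1..7`; built by `merge`, so
the term list is sorted for `EPoly.cmpExp` — efficiency only, soundness does not depend on it). -/
def linPoly (c : ℤ) (a : List ℤ) : EPoly :=
  (List.range 7).foldr (fun j acc => EPoly.merge (EPoly.var (a.getD j 0) (j + 1)) acc) (EPoly.const c)

/-- `Q·X` on a face / in the box: `mode = 0`: lower face `−w`; `1`: upper face `+w`; `2`: free `+ w·ε₈`;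
`3`: free `+ w·ε₉`. -/
def coordPoly (c : ℤ) (a : List ℤ) (w : ℕ) (mode : ℕ) : EPoly :=
  if mode = 0 then EPoly.merge (linPoly c a) (EPoly.const (-(w : ℤ)))
  else if mode = 1 then EPoly.merge (linPoly c a) (EPoly.const (w : ℤ))
  else if mode = 2 then EPoly.merge (linPoly c a) (EPoly.var (w : ℤ) 8)
  else EPoly.merge (linPoly c a) (EPoly.var (w : ℤ) 9)

/-- Product of a list of polynomials (merging after each product). -/
def prodPoly : List EPoly → EPoly
  | [] => EPoly.const 1
  | p :: ps => EPoly.mul p (prodPoly ps)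

section System
variable (t : Fin 8 → EPoly) (Q : ℕ) (X V : EPoly)
/- `t i` = Q·t_i, `X`, `V` = Q·X, Q·V. Every linear factor below is "Q·(linear form)". -/

/-- `Q⁴·F₁(X,Y)` = `(X+s₆)(s₀−X)(σ−X)(X+Y) − (X−s₄)(X−s₃)(X−s₅)(X+Y+s₆−s₀)` in atoms. -/
def f1Poly : EPoly :=
  let Y := V
  EPoly.merge
    (prodPoly [EPoly.merge X (t 6), EPoly.merge (t 0) (EPoly.smul (-1) X),
      EPoly.merge (EPoly.merge (t 3) (t 4)) (EPoly.merge (t 5) (EPoly.smul (-1) X)), EPoly.merge X Y])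
    (EPoly.smul (-1) (prodPoly [EPoly.merge X (EPoly.smul (-1) (t 4)), EPoly.merge X (EPoly.smul (-1) (t 3)),
      EPoly.merge X (EPoly.smul (-1) (t 5)),
      EPoly.merge (EPoly.merge X Y) (EPoly.merge (t 6) (EPoly.smul (-1) (t 0)))]))

/-- `Q⁴·F₂(X,Y)` = `(X+Y)(σ′−Y)(s₀−Y)(Y+s₆) − (X+Y+s₆−s₀)(Y−s₇)(Y−s₂)(Y−s₁)`. -/
def f2Poly : EPoly :=
  let Y := V
  EPoly.merge
    (prodPoly [EPoly.merge X Y,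
      EPoly.merge (EPoly.merge (t 1) (t 2)) (EPoly.merge (t 7) (EPoly.smul (-1) Y)),
      EPoly.merge (t 0) (EPoly.smul (-1) Y), EPoly.merge Y (t 6)])
    (EPoly.smul (-1) (prodPoly [EPoly.merge (EPoly.merge X Y) (EPoly.merge (t 6) (EPoly.smul (-1) (t 0))),
      EPoly.merge Y (EPoly.smul (-1) (t 7)), EPoly.merge Y (EPoly.smul (-1) (t 2)),
      EPoly.merge Y (EPoly.smul (-1) (t 1))]))

/-- `Q²·A₁(X)` and `Q⁴·B₁(X)` with `F₁(X,Y) = A₁(X)·Y + B₁(X)`: `A₁ = L − R`, `B₁ = L·X − R·(X+s₆−s₀)`,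
`L = (X+s₆)(s₀−X)(σ−X)`, `R = (X−s₄)(X−s₃)(X−s₅)` (so `Q³·A₁`, `Q⁴·B₁`). -/
def a1b1Poly : EPoly × EPoly :=
  let L := prodPoly [EPoly.merge X (t 6), EPoly.merge (t 0) (EPoly.smul (-1) X),
    EPoly.merge (EPoly.merge (t 3) (t 4)) (EPoly.merge (t 5) (EPoly.smul (-1) X))]
  let R := prodPoly [EPoly.merge X (EPoly.smul (-1) (t 4)), EPoly.merge X (EPoly.smul (-1) (t 3)),
    EPoly.merge X (EPoly.smul (-1) (t 5))]
  (EPoly.merge L (EPoly.smul (-1) R),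
   EPoly.merge (EPoly.mul L X) (EPoly.smul (-1) (EPoly.mul R (EPoly.merge X (EPoly.merge (t 6) (EPoly.smul (-1) (t 0)))))))

/-- `Q⁵·G₁(X,Z)` with `G₁ = Z·F₁(X,1/Z) = A₁(X) + B₁(X)·Z`: `Q²·(Q³A₁) + (Q⁴B₁)·(QZ)`. -/
def g1Poly : EPoly :=
  let AB := a1b1Poly t X
  EPoly.merge (EPoly.smul ((Q : ℤ) ^ 2) AB.1) (EPoly.mul AB.2 V)

/-- `Q²·c₂`, `Q³·c₁`, `Q⁴·c₀` with `F₂(X,Y) = c₂Y² + c₁Y + c₀`: `c₂ = (s₆−s₀)X − s₀s₆ − e₂`,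
`c₁ = (X+s₆)σ′s₀ − Xs₆(σ′+s₀) − (X+s₆−s₀)e₂ + e₃`, `c₀ = Xs₆σ′s₀ + (X+s₆−s₀)e₃` (`σ′, e₂, e₃` the elementary
symmetric functions of `s₁, s₂, s₇`). -/
def cPoly : EPoly × EPoly × EPoly :=
  let sp := EPoly.merge (EPoly.merge (t 1) (t 2)) (t 7)
  let e2 := EPoly.merge (EPoly.merge (EPoly.mul (t 1) (t 2)) (EPoly.mul (t 1) (t 7))) (EPoly.mul (t 2) (t 7))
  let e3 := EPoly.mul (EPoly.mul (t 1) (t 2)) (t 7)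
  let d := EPoly.merge (t 6) (EPoly.smul (-1) (t 0))
  let Xd := EPoly.merge X d
  (EPoly.merge (EPoly.mul d X) (EPoly.smul (-1) (EPoly.merge (EPoly.mul (t 0) (t 6)) e2)),
   EPoly.merge (EPoly.merge (EPoly.mul (EPoly.mul (EPoly.merge X (t 6)) sp) (t 0))
      (EPoly.smul (-1) (EPoly.mul (EPoly.mul X (t 6)) (EPoly.merge sp (t 0)))))
      (EPoly.merge (EPoly.smul (-1) (EPoly.mul Xd e2)) e3),
   EPoly.merge (EPoly.mul (EPoly.mul (EPoly.mul X (t 6)) sp) (t 0)) (EPoly.mul Xd e3))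

/-- `Q⁶·G₂(X,Z)` with `G₂ = Z²·F₂(X,1/Z) = c₂ + c₁Z + c₀Z²`: `Q⁴(Q²c₂) + Q²(Q³c₁)(QZ) + (Q⁴c₀)(QZ)²`. -/
def g2Poly : EPoly :=
  let C := cPoly t X
  EPoly.merge (EPoly.merge (EPoly.smul ((Q : ℤ) ^ 4) C.1) (EPoly.smul ((Q : ℤ) ^ 2) (EPoly.mul C.2.1 V)))
    (EPoly.mul C.2.2 (EPoly.mul V V))

end System

/-- One component (`second = false`: the first) of the preconditioned pair `(m₁₁P₁ + m₁₂P₂, m₂₁P₁ + m₂₂P₂)` of the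
chart's system at `(X, V)` (near: `(Q⁴F₁, Q⁴F₂)`; far: `(Q·Q⁵G₁, Q⁶G₂)`, both brought to `Q⁶`). -/
def sysPoly (D T : ℕ) (lo hi : List ℕ) (rd : RootData) (X V : EPoly) (second : Bool) : EPoly :=
  let t := tPoly D T lo hi
  let Q := 2 * D * T
  let P1 := if rd.far then EPoly.smul (Q : ℤ) (g1Poly t Q X V) else f1Poly t X V
  let P2 := if rd.far then g2Poly t Q X V else f2Poly t X V
  if second then EPoly.merge (EPoly.smul rd.m21 P1) (EPoly.smul rd.m22 P2)
  else EPoly.merge (EPoly.smul rd.m11 P1) (EPoly.smul rd.m12 P2)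

/-- **The four Poincaré–Miranda face conditions** (exact): `F̂₁ < 0` on the face `X = X̃ − wx` (second coordinate
free), `F̂₁ > 0` on `X = X̃ + wx`, `F̂₂ < 0` on `V = Ṽ − wv` (first coordinate free), `F̂₂ > 0` on `V = Ṽ + wv`. -/
def faceCheck (D T : ℕ) (lo hi : List ℕ) (rd : RootData) : Bool :=
  let Xlo := coordPoly rd.cx rd.ax rd.wx 0
  let Xhi := coordPoly rd.cx rd.ax rd.wx 1
  let Xfr := coordPoly rd.cx rd.ax rd.wx 2
  let Vlo := coordPoly rd.cv rd.av rd.wv 0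
  let Vhi := coordPoly rd.cv rd.av rd.wv 1
  let Vfr := coordPoly rd.cv rd.av rd.wv 2
  decide (EPoly.upper (sysPoly D T lo hi rd Xlo Vfr false) < 0) &&
  decide (0 < EPoly.lower (sysPoly D T lo hi rd Xhi Vfr false)) &&
  decide (EPoly.upper (sysPoly D T lo hi rd Xfr Vlo true) < 0) &&
  decide (0 < EPoly.lower (sysPoly D T lo hi rd Xfr Vhi true))

/-! ### Affine atoms (`AForm` at scale `SC`) -/

/-- An affine form for `(c + Σ_{j} a_j ε_j)/den` (coefficient list indexed from `ε₀`): entries rounded down,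
radius `|a| + 1`. -/
def linAF (c : ℤ) (a : List ℤ) (den : ℕ) : AForm :=
  ⟨c * (SC : ℤ) / den, a.map (fun b => b * (SC : ℤ) / den), a.length + 1⟩

/-- `t_i` as an affine form (`i = 1..7`; `t₀ = 1` exactly). -/
def tAF (D : ℕ) (lo hi : List ℕ) (i : Fin 8) : AForm :=
  if i = 0 then const (SC : ℤ)
  else linAF ((lo.getD i 0 : ℤ) + (hi.getD i 0 : ℤ)) (List.replicate i 0 ++ [(hi.getD i 0 : ℤ) - (lo.getD i 0 : ℤ)]) (2 * D)

/-- A box coordinate `(c + Σ_{j=1..7} a_j ε_j + w ε_k)/Q` as an affine form (`k = 8` or `9`). -/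
def coordAF (c : ℤ) (a : List ℤ) (w : ℕ) (k : ℕ) (Q : ℕ) : AForm :=
  linAF c (0 :: ((List.range 9).map fun j => if j + 1 = k then (w : ℤ) else if j < 7 then a.getD j 0 else 0)) Q

/-- Sum of a list of optional forms times forms: `Σ coef_k · log|arg_k|` (`none` if some `log` fails). -/
def logSum : List (AForm × AForm) → Option AForm
  | [] => some (const 0)
  | (co, arg) :: rest =>
    match AFormLog.logAbs SC arg, logSum rest with
    | some L, some R => some (add (mul SC co L) R)
    | _, _ => none

section Value
variable (t : Fin 8 → AForm) (X V : AForm)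

/-- The twelve coefficients `e_k` of the growth functional in symmetric coordinates (`growthLogR_aOfS`). -/
def coefs : List AForm :=
  [add (t 4) (t 6), add (t 3) (t 6), add (t 5) (t 6), add (t 0) (t 6), neg (add (t 0) (t 6)),
   neg (add (add (t 3) (t 4)) (add (t 5) (t 6))), mulInt (-2) (t 6), add (t 6) (t 7), add (t 2) (t 6),
   add (t 1) (t 6), neg (add (add (t 1) (t 2)) (add (t 6) (t 7))), neg (add (t 0) (t 6))]

/-- The twelve factors in the near chart `(X, Y)`: `X − s₄, X − s₃, X − s₅, X+Y+s₆−s₀, s₀−X, σ−X, X+Y, Y−s₇,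
Y−s₂, Y−s₁, σ′−Y, s₀−Y`. -/
def argsNear : List AForm :=
  let Y := V
  [sub X (t 4), sub X (t 3), sub X (t 5), add (add X Y) (sub (t 6) (t 0)), sub (t 0) X,
   sub (add (add (t 3) (t 4)) (t 5)) X, add X Y, sub Y (t 7), sub Y (t 2), sub Y (t 1),
   sub (add (add (t 1) (t 2)) (t 7)) Y, sub (t 0) Y]

/-- The twelve NUMERATORS in the far chart `(X, Z)`, `Y = 1/Z`: the five X-only factors unchanged, the seven
Y-factors multiplied by `Z`: `XZ+1+(s₆−s₀)Z, XZ+1, 1−s₇Z, 1−s₂Z, 1−s₁Z, σ′Z−1, s₀Z−1` (their `log|Z|` parts cancel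
identically — `ConeGammaCritBoxSound.growthLogR_far`). -/
def argsFar : List AForm :=
  let Z := V
  let one := const (SC : ℤ)
  let XZ1 := add (mul SC X Z) one
  [sub X (t 4), sub X (t 3), sub X (t 5), add XZ1 (mul SC (sub (t 6) (t 0)) Z), sub (t 0) X,
   sub (add (add (t 3) (t 4)) (t 5)) X, XZ1, sub one (mul SC (t 7) Z), sub one (mul SC (t 2) Z),
   sub one (mul SC (t 1) Z), sub (mul SC (add (add (t 1) (t 2)) (t 7)) Z) one, sub (mul SC (t 0) Z) one]

/-- The seven constant terms `(s₀−s₃)log(s₀−s₃) + (s₃+s₄)log(s₃+s₄) + (s₁+s₂)log(s₁+s₂) + (s₀−s₂)log(s₀−s₂)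
− (s₄+s₆)log(s₄+s₆) − (s₀−s₆)log(s₀−s₆) − (s₁+s₆)log(s₁+s₆)` as (coefficient, argument) pairs. -/
def constTerms : List (AForm × AForm) :=
  [(sub (t 0) (t 3), sub (t 0) (t 3)), (add (t 3) (t 4), add (t 3) (t 4)), (add (t 1) (t 2), add (t 1) (t 2)),
   (sub (t 0) (t 2), sub (t 0) (t 2)), (neg (add (t 4) (t 6)), add (t 4) (t 6)),
   (neg (sub (t 0) (t 6)), sub (t 0) (t 6)), (neg (add (t 1) (t 6)), add (t 1) (t 6))]

/-- The growth functional at the box point as an affine form (`none` if some argument is not sign-definite). -/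
def valueAF (far : Bool) : Option AForm :=
  logSum ((List.zip (coefs t) (if far then argsFar t X V else argsNear t X V)) ++ constTerms t)

end Value

/-- The value enclosure `[lo, hi]` (at scale `SC`) of the critical value in the box of `rd`, provided the four
face conditions hold, the widths are positive, `det M ≠ 0`, every argument is sign-definite, and in the far chart
`Z` is sign-definite. -/
def rootCheck (D T : ℕ) (lo hi : List ℕ) (rd : RootData) : Option (ℤ × ℤ) :=
  let Q := 2 * D * T
  let X := coordAF rd.cx rd.ax rd.wx 8 Q
  let V := coordAF rd.cv rd.av rd.wv 9 Q
  if faceCheck D T lo hi rd = true ∧ rd.ax.length = 7 ∧ rd.av.length = 7 ∧ 0 < rd.wx ∧ 0 < rd.wv ∧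
      (rd.far = true → ((rad V : ℤ) < -V.c ∨ (rad V : ℤ) < V.c)) ∧ rd.m11 * rd.m22 - rd.m12 * rd.m21 ≠ 0 then
    match valueAF (tAF D lo hi) X V rd.far with
    | some G => some (AForm.lo G, AForm.hi G)
    | none => none
  else none

/-- The box is an OPEN-box box: `0 < lo_i`, `hi_i < D` for `i = 1..7`, `lo_i < hi_i`, `lo₀ = hi₀ = D > 0`,
lists of length 8. -/
def boxOKc (D : ℕ) (lo hi : List ℕ) : Bool :=
  decide (0 < D ∧ lo.length = 8 ∧ hi.length = 8 ∧ lo.getD 0 0 = D ∧ hi.getD 0 0 = D ∧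
    ∀ j ∈ List.range 7, 0 < lo.getD (j + 1) 0 ∧ lo.getD (j + 1) 0 < hi.getD (j + 1) 0 ∧ hi.getD (j + 1) 0 < D)

/-- **The checker.** Three critical-point certificates with SEPARATED value enclosures `hi₀ < lo₁`, `hi₁ < lo₂`
(so the three critical values are `λ₁ < C₀ < C₁`), and the claimed bounds: `C₁ ≤ c1hi/den`, `c0lo/den ≤ C₀`
(both per unit `s₀`). -/
def critBoxCheck (D T : ℕ) (lo hi : List ℕ) (r0 r1 r2 : RootData) (c0lo c1hi : ℤ) (den : ℕ) : Bool :=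
  match rootCheck D T lo hi r0, rootCheck D T lo hi r1, rootCheck D T lo hi r2 with
  | some (_, h0), some (l1, h1), some (l2, h2) =>
      boxOKc D lo hi && decide (0 < T ∧ 0 < den ∧ h0 < l1 ∧ h1 < l2 ∧ h2 * (den : ℤ) ≤ c1hi * (SC : ℤ) ∧
        c0lo * (SC : ℤ) ≤ l1 * (den : ℤ))
  | _, _, _ => false

/-! ### The `δ₂₈` minorant and the assembled `γ` test -/

/-- `h_k(aOfS t)` as an integer linear form in `(t₀,…,t₇)` (`h28_aOfS`: the 21 pair sums `t_i + t_j`,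
`1 ≤ i < j ≤ 7`, and the 7 forms `t₀ − t_j`), in the order of `h28`: coefficient lists of length 8. -/
def h28Coef : Fin 28 → List ℤ :=
  ![[0,1,1,0,0,0,0,0], [1,0,-1,0,0,0,0,0], [0,0,1,1,0,0,0,0], [1,0,0,-1,0,0,0,0], [0,0,0,1,1,0,0,0], [0,0,0,0,0,1,1,0], [0,0,0,0,0,0,1,1], [0,0,0,1,0,1,0,0], [0,1,0,1,0,0,0,0], [0,1,0,0,1,0,0,0], [0,1,0,0,0,1,0,0], [1,0,0,0,-1,0,0,0], [1,0,0,0,0,-1,0,0], [0,0,1,0,0,0,1,0], [1,-1,0,0,0,0,0,0], [0,0,1,0,1,0,0,0], [1,0,0,0,0,0,-1,0], [0,0,1,0,0,1,0,0], [0,0,0,0,1,0,1,0], [0,0,0,1,0,0,0,1], [0,1,0,0,0,0,1,0], [0,1,0,0,0,0,0,1], [0,0,0,1,0,0,1,0], [1,0,0,0,0,0,0,-1], [0,0,0,0,1,1,0,0], [0,0,1,0,0,0,0,1], [0,0,0,0,0,1,0,1], [0,0,0,0,1,0,0,1]]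

/-- Exact lower bound (numerator over `D`) of `Σ_{j<5} h_{s5 j}(aOfS t)` over the box: `Σ_j minNum(h28Coef (s5 j))`. -/
def delta5Lower (lo hi : List ℕ) (s5 : Fin 5 → Fin 28) : ℤ :=
  LemmaFBox.minNum (h28Coef (s5 0)) lo hi + LemmaFBox.minNum (h28Coef (s5 1)) lo hi +
    LemmaFBox.minNum (h28Coef (s5 2)) lo hi + LemmaFBox.minNum (h28Coef (s5 3)) lo hi +
    LemmaFBox.minNum (h28Coef (s5 4)) lo hi

/-- **The assembled test** for `γ ≤ gnum/gden` on the box: with `C₁ ≤ c1hi/den`, `C₀ ≥ c0lo/den`,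
`δ₂₈ ≥ dlo/D` (five DISTINCT forms `s5`), `Φ ≤ p/q` (cert-2 g36's box bound), all per unit `s₀`:
`0 ≤ c0lo/den + dlo/D − p/q`, `0 < c1hi/den + dlo/D − p/q` and `(c1hi/den − c0lo/den)·gden ≤ gnum·(c1hi/den + dlo/D − p/q)`,
checked in integers over the common denominator `den·D·q`. -/
def gammaCheck (D : ℕ) (lo hi : List ℕ) (s5 : Fin 5 → Fin 28) (c0lo c1hi : ℤ) (den : ℕ) (p : ℤ) (q : ℕ)
    (gnum gden : ℕ) : Bool :=
  let dlo := delta5Lower lo hi s5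
  let C1 := c1hi * (D : ℤ) * (q : ℤ)
  let C0 := c0lo * (D : ℤ) * (q : ℤ)
  let DL := dlo * (den : ℤ) * (q : ℤ)
  let PH := p * (den : ℤ) * (D : ℤ)
  decide (Function.Injective s5 ∧ 0 < den ∧ 0 < q ∧ 0 < D ∧ 0 < gden ∧ 0 ≤ C0 + DL - PH ∧ 0 < C1 + DL - PH ∧
    (C1 - C0) * (gden : ℤ) ≤ (gnum : ℤ) * (C1 + DL - PH))

end CritBox

end Summit.KontsevichZagierPeriods.Zeta5Search.Barrier.ConeGamma
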